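import Summits.Ventures.LatticeQCDFlow.Scaling.LumpedStarStepChain
import Summits.Ventures.LatticeQCDFlow.Scaling.AdjacentPathBound
import Literature.Probability.MarkovChains.NetworkReduction

/-!
HONEST FRAMING: exact (Metropolis-corrected) sampling algorithms for lattice gauge theory; figures
of merit are autocorrelation/cost numbers at stated couplings and volumes; no continuum-physics
claim.

# LumpedStarIrreducible — THE STEP CHAIN OF THE LUMPED STAR IS IRREDUCIBLE WHEN `μ_0 > 0` AND `0 < σ < 1` (a redraw reaches any fresh content; a redraw followed by a swap moves
# one cold particle from a surplus content to a deficit content; induction on the composition distance of chapter V) (lean-2 GEN-38, ours)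

Venture-side (OURS).  Cell `lqcd-flow` (pub-lqcd), unit `pub-lqcd-lean-2-g38`, 2026-08-30.  Chapter X (item 1 (i) (b)), file 7: the irreducibility hypothesis of X6 discharged.  With the
closed-set criterion of the tree (`Literature/…/NetworkReduction.isIrreducible_of_forall_closed`): a set of states closed under positive steps of `S = σA + (1−σ)B` is closed under
redraws (`(1−σ)μ_0(z) > 0`) and under swaps to present contents (`σN(v)acc/K > 0`); from `u` with cold composition `M` to `y` with cold composition `M'` one redraw (to a deficit
content `b`) and one swap (with a surplus content `a`) lower the distance `Δ(M,M')` by one (W18 `adjacent_step_dist_pred`), and at distance `0` one redraw reaches `y`.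
Hypothesis-equations, no definitions.

## What is proved

* `starStep_closed_redraw`, `starStep_closed_swap`, `starStep_reach`, **`lumpedStar_step_irreducible`**.

Literature grade (cell rule): OWN, elementary; the closed-set criterion is the tree's; nothing cited as a fact; no new bib keys.
-/

open Finset
open Literature.Probability.MarkovChains

namespace Summit.Ventures.LatticeQCDFlow.Scaling

section StarIrred
variable {X : Type*} [Fintype X] [DecidableEq X] {S : Type*} [Fintype S] [DecidableEq S]
variable {hub : X → S} {comp : X → S → ℕ} {K : ℕ} {μ0 W : S → ℝ} {σ : ℝ} {acc : S → S → ℝ} {Kh : (S → ℕ) → S → S → ℝ}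
variable {Ast Bst Sst : X → X → ℝ}

omit [Fintype X] [DecidableEq X] in
/-- A set closed under positive steps of `S` is closed under redraws. [ours] -/
theorem starStep_closed_redraw (hW : ∀ v, 0 < W v) (hacc : ∀ h v, acc h v = min 1 (W h / W v)) (hK : 1 ≤ K) (hsum : ∀ x, ∑ v, comp x v = K + 1)
    (hKoff : ∀ N h v, h ≠ v → Kh N h v = if N h = 0 then 0 else (N v : ℝ) / K * acc h v) (hKdiag : ∀ N h, Kh N h h = 1 - ∑ v ∈ univ.erase h, Kh N h v)
    (hμpos : ∀ v, 0 < μ0 v) (hσ0 : 0 ≤ σ) (hσ1 : σ < 1)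
    (hA : ∀ x x', Ast x x' = if comp x' = comp x then Kh (comp x) (hub x) (hub x') else 0)
    (hB : ∀ x x', Bst x x' = μ0 (hub x') * (if comp x' + Pi.single (hub x) 1 = comp x + Pi.single (hub x') 1 then 1 else 0))
    (hS : ∀ x x', Sst x x' = σ * Ast x x' + (1 - σ) * Bst x x')
    {T : Finset X} (hcl : ∀ u ∈ T, ∀ w, 0 < Sst u w → w ∈ T) {u w : X} (hu : u ∈ T) (hw : comp w + Pi.single (hub u) 1 = comp u + Pi.single (hub w) 1) : w ∈ T := by
  refine hcl u hu w ?_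
  rw [hS, hB, if_pos hw, mul_one]
  have hA0 : 0 ≤ Ast u w := starStep_swap_nonneg hW hacc hK hsum hKoff hKdiag hA u w
  have : 0 < (1 - σ) * μ0 (hub w) := mul_pos (by linarith) (hμpos _)
  nlinarith [mul_nonneg hσ0 hA0]

omit [Fintype X] [DecidableEq X] in
/-- A set closed under positive steps of `S` is closed under swaps to another present content (`σ > 0`). [ours] -/
theorem starStep_closed_swap (hhub : ∀ x, comp x (hub x) ≠ 0) (hW : ∀ v, 0 < W v) (hacc : ∀ h v, acc h v = min 1 (W h / W v)) (hK : 1 ≤ K)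
    (hKoff : ∀ N h v, h ≠ v → Kh N h v = if N h = 0 then 0 else (N v : ℝ) / K * acc h v)
    (hμ0 : ∀ v, 0 ≤ μ0 v) (hσpos : 0 < σ) (hσ1 : σ < 1)
    (hA : ∀ x x', Ast x x' = if comp x' = comp x then Kh (comp x) (hub x) (hub x') else 0)
    (hB : ∀ x x', Bst x x' = μ0 (hub x') * (if comp x' + Pi.single (hub x) 1 = comp x + Pi.single (hub x') 1 then 1 else 0))
    (hS : ∀ x x', Sst x x' = σ * Ast x x' + (1 - σ) * Bst x x')
    {T : Finset X} (hcl : ∀ u ∈ T, ∀ w, 0 < Sst u w → w ∈ T) {u w : X} (hu : u ∈ T) (hc : comp w = comp u) (hne : hub w ≠ hub u) : w ∈ T := by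
  refine hcl u hu w ?_
  rw [hS, hA, if_pos hc, hKoff _ _ _ (Ne.symm hne), if_neg (hhub u)]
  have hB0 : 0 ≤ Bst u w := by rw [hB]; exact mul_nonneg (hμ0 _) (by split_ifs <;> norm_num)
  have hpres : 0 < (comp u (hub w) : ℝ) := by rw [← hc]; exact_mod_cast Nat.pos_of_ne_zero (hhub w)
  have hacc0 : 0 < acc (hub u) (hub w) := by rw [hacc]; exact lt_min one_pos (div_pos (hW _) (hW _))
  have hK0 : (0 : ℝ) < K := by exact_mod_cast hK
  have : 0 < σ * ((comp u (hub w) : ℝ) / K * acc (hub u) (hub w)) := by positivity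
  nlinarith [mul_nonneg (show (0:ℝ) ≤ 1 - σ by linarith) hB0]

variable {Δ : (S → ℕ) → (S → ℕ) → ℕ}

omit [Fintype X] [DecidableEq X] in
/-- **Reachability:** in a closed set containing `u` (cold composition `M`), every state `y` (cold composition `M'`) with `Δ(M,M') ≤ d` lies in the set. [ours] -/
theorem starStep_reach
    (hsurj : ∀ (z : S) (N : S → ℕ), ∑ v, N v = K + 1 → N z ≠ 0 → ∃ x, hub x = z ∧ comp x = N) (hhub : ∀ x, comp x (hub x) ≠ 0)
    (hW : ∀ v, 0 < W v) (hacc : ∀ h v, acc h v = min 1 (W h / W v)) (hK : 1 ≤ K) (hsum : ∀ x, ∑ v, comp x v = K + 1)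
    (hKoff : ∀ N h v, h ≠ v → Kh N h v = if N h = 0 then 0 else (N v : ℝ) / K * acc h v) (hKdiag : ∀ N h, Kh N h h = 1 - ∑ v ∈ univ.erase h, Kh N h v)
    (hμpos : ∀ v, 0 < μ0 v) (hσpos : 0 < σ) (hσ1 : σ < 1)
    (hA : ∀ x x', Ast x x' = if comp x' = comp x then Kh (comp x) (hub x) (hub x') else 0)
    (hB : ∀ x x', Bst x x' = μ0 (hub x') * (if comp x' + Pi.single (hub x) 1 = comp x + Pi.single (hub x') 1 then 1 else 0))
    (hS : ∀ x x', Sst x x' = σ * Ast x x' + (1 - σ) * Bst x x')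
    (hΔ : ∀ N N', Δ N N' = ∑ v, (N v - N' v))
    {T : Finset X} (hcl : ∀ u ∈ T, ∀ w, 0 < Sst u w → w ∈ T) :
    ∀ (d : ℕ) (u : X), u ∈ T → ∀ (M M' : S → ℕ) (y : X), comp u = M + Pi.single (hub u) 1 → comp y = M' + Pi.single (hub y) 1 → Δ M M' ≤ d → y ∈ T := by
  have hμ0 : ∀ v, 0 ≤ μ0 v := fun v => (hμpos v).le
  -- totals of cold compositions
  have htot : ∀ (x : X) (M : S → ℕ), comp x = M + Pi.single (hub x) 1 → ∑ v, M v = K := by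
    intro x M hM
    have h := hsum x
    rw [hM] at h; simp only [Pi.add_apply] at h
    rw [sum_add_distrib, Finset.sum_pi_single'] at h; simp at h; omega
  -- distance zero: one redraw
  have hzero : ∀ u, u ∈ T → ∀ (M M' : S → ℕ) (y : X), comp u = M + Pi.single (hub u) 1 → comp y = M' + Pi.single (hub y) 1 → Δ M M' = 0 → y ∈ T := by
    intro u hu M M' y hM hM' hd
    have hle : ∀ v, M v ≤ M' v := (cdist_eq_zero_iff hΔ M M').mp hd
    have heq : M = M' := by
      have hs : ∑ v, M v = ∑ v, M' v := by rw [htot u M hM, htot y M' hM']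
      funext v
      exact ((Finset.sum_eq_sum_iff_of_le fun v _ => hle v).mp hs) v (mem_univ v)
    subst heq
    exact starStep_closed_redraw hW hacc hK hsum hKoff hKdiag hμpos hσpos.le hσ1 hA hB hS hcl hu (by rw [hM', hM]; abel)
  intro d
  induction d with
  | zero => intro u hu M M' y hM hM' hd; exact hzero u hu M M' y hM hM' (Nat.le_zero.mp hd)
  | succ d ih =>
    intro u hu M M' y hM hM' hd
    by_cases h0 : Δ M M' = 0
    · exact hzero u hu M M' y hM hM' h0
    · -- a surplus content `a` and a deficit content `b`
      obtain ⟨a, ha⟩ := cdist_pos_exists_surplus hΔ h0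
      have hsymm : Δ M' M = Δ M M' := (cdist_symm_of_sum_eq hΔ (by rw [htot u M hM, htot y M' hM'])).symm
      obtain ⟨b, hb⟩ := cdist_pos_exists_surplus hΔ (N := M') (N' := M) (by rw [hsymm]; exact h0)
      have hab : a ≠ b := by intro e; subst e; omega
      -- the moved cold composition `M₁ = M − δ_a + δ_b`
      set M₁ : S → ℕ := fun v => if v = a then M v - 1 else if v = b then M v + 1 else M v with hM₁def
      have hM₁ : ∀ v, M₁ v = if v = a then M v - 1 else if v = b then M v + 1 else M v := fun v => rfl
      have hd₁ : Δ M₁ M' ≤ d := by have := adjacent_step_dist_pred hΔ hab ha hb hM₁; omega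
      -- step 1: redraw to `b`: the state `u₁` with hub `b` and composition `M + δ_b`
      have hsum₁ : ∑ v, (M + Pi.single b 1 : S → ℕ) v = K + 1 := by
        simp only [Pi.add_apply]; rw [sum_add_distrib, Finset.sum_pi_single']; simp [htot u M hM]
      obtain ⟨u₁, hu₁h, hu₁c⟩ := hsurj b (M + Pi.single b 1) hsum₁ (by simp)
      have hu₁T : u₁ ∈ T := starStep_closed_redraw hW hacc hK hsum hKoff hKdiag hμpos hσpos.le hσ1 hA hB hS hcl hu (by rw [hu₁c, hM, hu₁h]; abel)
      -- step 2: swap the hub `b` with a cold particle of content `a`: the state `u₂` with hub `a`, same composition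
      have hMa : 1 ≤ M a := by omega
      obtain ⟨u₂, hu₂h, hu₂c⟩ := hsurj a (M + Pi.single b 1) hsum₁ (by simp [Pi.single_eq_of_ne hab]; omega)
      have hu₂T : u₂ ∈ T := starStep_closed_swap hhub hW hacc hK hKoff hμ0 hσpos hσ1 hA hB hS hcl hu₁T (by rw [hu₂c, hu₁c]) (by rw [hu₂h, hu₁h]; exact hab)
      -- `comp u₂ = M₁ + δ_a`
      have hu₂M : comp u₂ = M₁ + Pi.single (hub u₂) 1 := by
        rw [hu₂c, hu₂h]; funext v; simp only [Pi.add_apply, Pi.single_apply, hM₁]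
        by_cases hva : v = a
        · subst hva; simp [hab]; omega
        · by_cases hvb : v = b
          · subst hvb; simp [hva]
          · simp [hva, hvb]
      exact ih u₂ hu₂T M₁ M' y hu₂M hM' hd₁

/-- **THE STEP CHAIN OF THE LUMPED STAR IS IRREDUCIBLE** (`μ_0 > 0`, `0 < σ < 1`). [ours] -/
theorem lumpedStar_step_irreducible [Nonempty X]
    (hsurj : ∀ (z : S) (N : S → ℕ), ∑ v, N v = K + 1 → N z ≠ 0 → ∃ x, hub x = z ∧ comp x = N) (hhub : ∀ x, comp x (hub x) ≠ 0)
    (hW : ∀ v, 0 < W v) (hacc : ∀ h v, acc h v = min 1 (W h / W v)) (hK : 1 ≤ K) (hsum : ∀ x, ∑ v, comp x v = K + 1)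
    (hKoff : ∀ N h v, h ≠ v → Kh N h v = if N h = 0 then 0 else (N v : ℝ) / K * acc h v) (hKdiag : ∀ N h, Kh N h h = 1 - ∑ v ∈ univ.erase h, Kh N h v)
    (hμpos : ∀ v, 0 < μ0 v) (hσpos : 0 < σ) (hσ1 : σ < 1)
    (hA : ∀ x x', Ast x x' = if comp x' = comp x then Kh (comp x) (hub x) (hub x') else 0)
    (hB : ∀ x x', Bst x x' = μ0 (hub x') * (if comp x' + Pi.single (hub x) 1 = comp x + Pi.single (hub x') 1 then 1 else 0))
    (hS : ∀ x x', Sst x x' = σ * Ast x x' + (1 - σ) * Bst x x') : IsIrreducible Sst := by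
  classical
  have hμ0 : ∀ v, 0 ≤ μ0 v := fun v => (hμpos v).le
  have hS0 : ∀ x y, 0 ≤ Sst x y := fun x y => by
    rw [hS]
    have hA0 := starStep_swap_nonneg hW hacc hK hsum hKoff hKdiag hA x y
    have hB0 : 0 ≤ Bst x y := by rw [hB]; exact mul_nonneg (hμ0 _) (by split_ifs <;> norm_num)
    have : 0 ≤ 1 - σ := by linarith
    positivity
  refine isIrreducible_of_forall_closed hS0 fun T hT hcl => ?_
  obtain ⟨u, hu⟩ := hT
  refine eq_univ_of_forall fun y => ?_
  -- cold compositions of `u` and `y`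
  have hcold : ∀ x : X, ∃ M : S → ℕ, comp x = M + Pi.single (hub x) 1 := fun x => by
    refine ⟨comp x - Pi.single (hub x) 1, ?_⟩
    funext v; simp only [Pi.add_apply, Pi.sub_apply, Pi.single_apply]
    by_cases hv : v = hub x
    · subst hv; simp; have := Nat.one_le_iff_ne_zero.mpr (hhub x); omega
    · simp [hv]
  obtain ⟨M, hM⟩ := hcold u
  obtain ⟨M', hM'⟩ := hcold y
  exact starStep_reach (Δ := fun N N' => ∑ v, (N v - N' v)) hsurj hhub hW hacc hK hsum hKoff hKdiag hμpos hσpos hσ1 hA hB hS (fun _ _ => rfl) hcl _ u hu M M' y hM hM' le_rfl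

end StarIrred

end Summit.Ventures.LatticeQCDFlow.Scaling
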